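import Mathlib
import Summits.KontsevichZagierPeriods.KontsevichZagierPeriods.Theorems.SoloInformedLiftMoves
import Summits.KontsevichZagierPeriods.KontsevichZagierPeriods.Theorems.SoloInformedIsogenyChain
import Literature.NumberTheory.Transcendental.KZDirichletPeeling
import Literature.NumberTheory.Transcendental.KZMellinFibres
import HarnessLib
import HarnessLib.Audit

/-!
# SoloInformed — the torsion chain `⟦β(⅓,⅙)⟧ = 2⟦β(⅓,½)⟧`, I: the master representation

The period `∫_{−1}^{∞} dX/√(X³ + 1)` of the CM elliptic curve `E : y² = X³ + 1`, written in the
compact coordinate `w = 1/(X + 2) ∈ (0,1)`:  `X³ + 1 = Q(w)/w³` with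
`Q(w) = (1 − 2w)³ + w³ = (1 − w)(7w² − 5w + 1) > 0`, and `dX/y = w^{−1/2} Q(w)^{−1/2} dw`.
This file builds the **master representation** `M_κ = [(0,1), κ · w^{−1/2} Q(w)^{−1/2}]`
(`soloInformedTorsionRep κ`; semialgebraic as an Euler–Mellin monomial, absolutely convergent by
comparison with Euler's `B(½,½)` integrand since `Q(w) ≥ (3/28)(1 − w)`), and the generic
one-variable substitution toolkit used by the chain (injectivity by Rolle, image by intermediate
values: `soloInformed_Ioo_substitution`).

The chain itself (`SoloInformedTorsionChain`): `β(⅓,⅙) = M₃|_{(0,½)}` and `β(⅓,½) = M₃|_{(½,1)}`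
by the rational substitutions `t = (1 − 2w)³/Q(w)` and `t = ((2w − 1)/w)³`
(`SoloInformedTorsionBetaLifts`), and the multiplication-by-`3` endomorphism `σ` of `E`, a
`3 : 1` rational self-map of `(0,1)` with `σ*(dX/y) = 3·dX/y` (`SoloInformedTriplingMap`,
`SoloInformedTriplingMove`), identifies each of the three monotonicity pieces of `M₃` with `M₁`;
whence `⟦β(⅓,⅙)⟧ = 2⟦M₁⟧ = 2⟦β(⅓,½)⟧` — a torsion-type relation (`Γ`-value identity
`B(⅓,⅙) = 2B(⅓,½)`) obtained inside Kontsevich–Zagier's calculus WITHOUT the cancellation rule.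
Residency `solo-KontsevichZagierPeriods-informed` (s23); paper §6octies (vii).

References: M. Kontsevich, D. Zagier, *Periods* (2001), §1.2 (rules 1–3); J. H. Silverman,
*The Arithmetic of Elliptic Curves*, III.2–III.4 (multiplication-by-`m`, invariant differential
`[m]^*ω = mω`); Andrews–Askey–Roy (1999), Thm. 1.1.4 (Beta integral).
-/

noncomputable section

open MeasureTheory Set Filter
namespace Summit.KontsevichZagierPeriods.KontsevichZagierPeriods.Theorems

open Literature.NumberTheory.Transcendental Literature.NumberTheory.Transcendental.KZ
open Literature.ModelTheory.ExponentialFields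

/-! ### The cubic `Q(w) = (1 − 2w)³ + w³` -/

/-- `Q(w) = (1 − 2w)³ + w³ = 1 − 6w + 12w² − 7w³`; in the coordinate `w = 1/(X + 2)` on the
curve `y² = X³ + 1` one has `X³ + 1 = Q(w)/w³`. [this work] -/
def soloInformedTorsionQ (w : ℝ) : ℝ := (1 - 2 * w) ^ 3 + w ^ 3

/-- `Q(w) = (1 − w)(7w² − 5w + 1)`. [this work] -/
theorem soloInformed_torsionQ_eq (w : ℝ) :
    soloInformedTorsionQ w = (1 - w) * (7 * w ^ 2 - 5 * w + 1) := by
  unfold soloInformedTorsionQ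
  ring

/-- `7w² − 5w + 1 = 7(w − 5/14)² + 3/28 > 0`. [this work] -/
theorem soloInformed_torsionQuad_pos (w : ℝ) : 0 < 7 * w ^ 2 - 5 * w + 1 := by
  nlinarith [sq_nonneg (w - 5 / 14)]

/-- `Q > 0` on `(−∞, 1)`. [this work] -/
theorem soloInformed_torsionQ_pos {w : ℝ} (hw : w < 1) : 0 < soloInformedTorsionQ w := by
  rw [soloInformed_torsionQ_eq]
  exact mul_pos (sub_pos.2 hw) (soloInformed_torsionQuad_pos w)

/-- `Q(w) ≥ (3/28)(1 − w)` for `w ≤ 1` (the lower bound that makes `Q^{−1/2}` integrable).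
[this work] -/
theorem soloInformed_torsionQ_ge {w : ℝ} (hw : w ≤ 1) :
    3 / 28 * (1 - w) ≤ soloInformedTorsionQ w := by
  rw [soloInformed_torsionQ_eq]
  have h1 : 0 ≤ 1 - w := sub_nonneg.2 hw
  have h2 : 3 / 28 ≤ 7 * w ^ 2 - 5 * w + 1 := by nlinarith [sq_nonneg (w - 5 / 14)]
  nlinarith [mul_le_mul_of_nonneg_left h2 h1]

/-! ### The master representation `[(0,1), κ · w^{−1/2} Q(w)^{−1/2}]` -/

/-- The integrand `κ · w^{−1/2} · Q(w)^{−1/2}` on `ℝ¹` (for `κ = 1` this is `dX/y` on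
`y² = X³ + 1`, `X > −1`, in the coordinate `w = 1/(X + 2)`). [this work] -/
def soloInformedTorsionFun (κ : ℚ) (x : Fin 1 → ℝ) : ℝ :=
  (κ : ℝ) * ((x 0) ^ (-1 / 2 : ℝ) * (soloInformedTorsionQ (x 0)) ^ (-1 / 2 : ℝ))

/-- The integrand is `ℚ`-semialgebraic on `(0,1)` (an Euler–Mellin monomial in `w` and `Q(w)`).
[Kontsevich–Zagier 2001, §1.1] -/
theorem soloInformed_isSemialgebraicFunOn_torsionFun (κ : ℚ) :
    IsSemialgebraicFunOn ℚ {x : Fin 1 → ℝ | x 0 ∈ Ioo (0:ℝ) 1} (soloInformedTorsionFun κ) := by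
  refine (isSemialgebraicFunOn_mellinIntegrand BallPeeling.isSemialgebraic_posIoo
    ![MvPolynomial.X 0, (1 - MvPolynomial.C 2 * MvPolynomial.X 0) ^ 3 + MvPolynomial.X 0 ^ 3]
    ![-1 / 2, -1 / 2] κ (fun x hx k => ?_)).congr fun x _ => ?_
  · have hx' : 0 < x 0 ∧ x 0 < 1 := hx
    fin_cases k
    · simpa using hx'.1
    · have h := soloInformed_torsionQ_pos hx'.2
      unfold soloInformedTorsionQ at h
      simpa using h
  · simp [mellinIntegrand_apply, Fin.prod_univ_two, soloInformedTorsionFun, soloInformedTorsionQ]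

/-- Continuity of the integrand on `(0,1)`. [this work] -/
theorem soloInformed_continuousOn_torsionFun (κ : ℚ) :
    ContinuousOn (soloInformedTorsionFun κ) {x : Fin 1 → ℝ | x 0 ∈ Ioo (0:ℝ) 1} := by
  intro x hx
  have hx' : 0 < x 0 ∧ x 0 < 1 := hx
  refine ContinuousAt.continuousWithinAt ?_
  have h0 : ContinuousAt (fun y : Fin 1 → ℝ => y 0) x := (continuous_apply 0).continuousAt
  have hQ : ContinuousAt (fun y : Fin 1 → ℝ => soloInformedTorsionQ (y 0)) x :=
    ((by unfold soloInformedTorsionQ; fun_prop) :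
      Continuous fun y : Fin 1 → ℝ => soloInformedTorsionQ (y 0)).continuousAt
  exact continuousAt_const.mul ((h0.rpow_const (Or.inl hx'.1.ne')).mul
    (hQ.rpow_const (Or.inl (soloInformed_torsionQ_pos hx'.2).ne')))

/-- Absolute convergence: `|κ| w^{−1/2} Q(w)^{−1/2} ≤ |κ| (3/28)^{−1/2} · w^{−1/2}(1 − w)^{−1/2}`,
a multiple of Euler's `B(½,½)` integrand. [Andrews–Askey–Roy 1999, Thm. 1.1.4] -/
theorem soloInformed_integrableOn_torsionFun (κ : ℚ) :
    IntegrableOn (soloInformedTorsionFun κ) {x : Fin 1 → ℝ | x 0 ∈ Ioo (0:ℝ) 1} := by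
  obtain ⟨B, hBd, hBi⟩ := exists_betaRep' (1 / 2) (1 / 2) (by norm_num) (by norm_num)
  have hBint := B.integrableOn
  rw [hBd, hBi] at hBint
  have hmeas : MeasurableSet {x : Fin 1 → ℝ | x 0 ∈ Ioo (0:ℝ) 1} :=
    measurableSet_Ioo.preimage (measurable_pi_apply 0)
  have he : (((1 / 2 : ℚ) : ℝ) - 1) = (-1 / 2 : ℝ) := by norm_num
  refine Integrable.mono' (hBint.const_mul (|(κ : ℝ)| * (3 / 28 : ℝ) ^ (-1 / 2 : ℝ)))
    ((soloInformed_continuousOn_torsionFun κ).aestronglyMeasurable hmeas) ?_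
  refine (ae_restrict_iff' hmeas).mpr (ae_of_all _ fun x hx => ?_)
  have hx' : 0 < x 0 ∧ x 0 < 1 := hx
  have ht : 0 < x 0 := hx'.1
  have h1t : 0 < 1 - x 0 := sub_pos.2 hx'.2
  have hQ : 0 < soloInformedTorsionQ (x 0) := soloInformed_torsionQ_pos hx'.2
  have hQpow : soloInformedTorsionQ (x 0) ^ (-1 / 2 : ℝ) ≤
      (3 / 28 : ℝ) ^ (-1 / 2 : ℝ) * (1 - x 0) ^ (-1 / 2 : ℝ) := by
    rw [← Real.mul_rpow (by norm_num) h1t.le]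
    exact Real.rpow_le_rpow_of_nonpos (by positivity) (soloInformed_torsionQ_ge hx'.2.le)
      (by norm_num)
  rw [Real.norm_eq_abs, he]
  unfold soloInformedTorsionFun
  rw [abs_mul, abs_of_pos (mul_pos (Real.rpow_pos_of_pos ht _) (Real.rpow_pos_of_pos hQ _))]
  calc |(κ : ℝ)| * ((x 0) ^ (-1 / 2 : ℝ) * soloInformedTorsionQ (x 0) ^ (-1 / 2 : ℝ))
      ≤ |(κ : ℝ)| * ((x 0) ^ (-1 / 2 : ℝ) * ((3 / 28 : ℝ) ^ (-1 / 2 : ℝ) *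
          (1 - x 0) ^ (-1 / 2 : ℝ))) := by gcongr
    _ = |(κ : ℝ)| * (3 / 28 : ℝ) ^ (-1 / 2 : ℝ) * ((x 0) ^ (-1 / 2 : ℝ) *
          (1 - x 0) ^ (-1 / 2 : ℝ)) := by ring

/-- **The master representation** `M_κ = [(0,1), κ · w^{−1/2} Q(w)^{−1/2}]` (`κ = 1`: the period
`∫_{−1}^{∞} dX/√(X³+1)` of the CM curve `y² = X³ + 1` in the coordinate `w = 1/(X + 2)`).
[this work] -/
def soloInformedTorsionRep (κ : ℚ) : IntegralRep 1 where
  domain := {x | x 0 ∈ Ioo (0:ℝ) 1}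
  integrand := soloInformedTorsionFun κ
  isSemialgebraic_domain := BallPeeling.isSemialgebraic_posIoo
  isSemialgebraicFunOn_integrand := soloInformed_isSemialgebraicFunOn_torsionFun κ
  integrableOn := soloInformed_integrableOn_torsionFun κ

/-! ### Generic interval substitutions: injectivity by Rolle, image by intermediate values -/

/-- **Interval substitution data.** A function continuous on `[a,b]` with a nowhere-vanishing
derivative on `(a,b)`, mapping `(a,b)` into `(c,d)` with `{g a, g b} = {c, d}`, is injective on
`(a,b)` (Rolle) and maps `(a,b)` ONTO `(c,d)` (intermediate values). [folklore] -/
theorem soloInformed_Ioo_substitution {g g' : ℝ → ℝ} {a b c d : ℝ} (hab : a ≤ b)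
    (hcont : ContinuousOn g (Icc a b)) (hder : ∀ t ∈ Ioo a b, HasDerivAt g (g' t) t)
    (hne : ∀ t ∈ Ioo a b, g' t ≠ 0) (hmaps : MapsTo g (Ioo a b) (Ioo c d))
    (hends : (g a = c ∧ g b = d) ∨ (g a = d ∧ g b = c)) :
    InjOn g (Ioo a b) ∧ g '' Ioo a b = Ioo c d := by
  refine ⟨fun x hx y hy hxy => ?_, Subset.antisymm hmaps.image_subset ?_⟩
  · by_contra h
    rcases lt_or_gt_of_ne h with hlt | hlt
    · obtain ⟨e, he, he0⟩ := exists_hasDerivAt_eq_zero hlt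
        (hcont.mono (Icc_subset_Icc hx.1.le hy.2.le)) hxy
        (fun t ht => hder t ⟨lt_trans hx.1 ht.1, lt_trans ht.2 hy.2⟩)
      exact hne e ⟨lt_trans hx.1 he.1, lt_trans he.2 hy.2⟩ he0
    · obtain ⟨e, he, he0⟩ := exists_hasDerivAt_eq_zero hlt
        (hcont.mono (Icc_subset_Icc hy.1.le hx.2.le)) hxy.symm
        (fun t ht => hder t ⟨lt_trans hy.1 ht.1, lt_trans ht.2 hx.2⟩)
      exact hne e ⟨lt_trans hy.1 he.1, lt_trans he.2 hx.2⟩ he0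
  · rcases hends with ⟨ha, hb⟩ | ⟨ha, hb⟩
    · have h := intermediate_value_Ioo hab hcont
      rwa [ha, hb] at h
    · have h := intermediate_value_Ioo' hab hcont
      rwa [ha, hb] at h

end Summit.KontsevichZagierPeriods.KontsevichZagierPeriods.Theorems

end
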